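import Summits.QuantumFields.BalabanUV.Beta.FP.TowerDoorDefectTorusPieces

/-!
# `BalabanUV.Beta.FP.TowerDoorDefectTorus` — road «FP», binder row D1: **(T2)'s SECOND SOCKET — `perF T ∘ dper T` OF THE WARD-DEFECT KERNEL OF A BOUNDED `T`-PERIODIC GAUGE FUNCTION IS
# v10's DEFECT BRACKET** (the torus gradient of `Λ` against the source-periodised symmetrised mixed table, minus `κ₂`× the commutator of `diag Λ` with the periodised Hessian table —
# v10 `hWΔT`'s bracket LITERALLY, with `(M₂ n B) b β` replaced by `hM₂`'s right side and `lv(…) s` by `Λ ↑s`; an2 g78 A-1 l.68803 (Q-FP-55-1 = YES, shape requested verbatim);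
# an2 PART 70 `TowerDoorPeriodisedLinear` + road `TowerDoorDefectTorusPieces` by name.)

WHAT ([folklore] `perZ ∘ dper` bookkeeping BY NAME; generic letters `L tabs κ₂ Mc T` (`T i = L·Mc i`), a BOUNDED `T`-PERIODIC `Λ`; (Lmix) `LocStencilFM L tabs.mixFF C δ` (`δ > 0`), (LH)
`VertexFamily tabs.H L C_H δH` (`δH > 0`); no `def`, no `def … : Prop`, nothing cited, 0 sorry, default heartbeats).
§1 **`perZ_dper_defKerZ_inl_inl`** — THE ENTRY: `perZ T (dper T (defKerZ L tabs κ₂ Λ β)) x̄ w̄ (inl α) (inl α′) = Σ_{(r,κ)} (Λ(↑r+e_κ) − Λ ↑r)·perZ T (dper T (Σ'_m M2Z (↑r,κ) (translate Mc β.1 m, β.2))) x̄ w̄ (inl α)(inl α′)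
− κ₂·(Λ x̄·Ĉ − Ĉ·Λ w̄)`, `Ĉ := perZ T (dper T (tabs.H β.2 β.1)) x̄ w̄ (inl α)(inl α′)` (PART 62 `defKerZ_apply_inl_inl` pointwise under PART 70 `perZ_dper_apply`; PART 70 `perZ_dper_sub ∕ _finset_sum ∕
_const_mul` with `summable_perZ_dper_of_biLoc` on PART 64 `biLoc_gradTerm` and the pieces' `biLoc_rowK ∕ biLoc_colK`; then `perZ_dper_gradK ∕ _rowK ∕ _colK`).
§2 **`submatrix_perF_dper_defKerZ`** — THE MATRIX ON THE `ff` BLOCK, in the shape an2 g78 asked for: for `βc : ↥(pbox Mc) × Fin 4`,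
`(perF T (dper T (defKerZ L tabs κ₂ Λ (↑βc.1, βc.2))))|ff = Σ_{b : ↥(pbox T) × Fin 4} (Σ_s tgrad T (b.1, inl b.2) s · Λ ↑s) • (perF T (dper T (X Z i₁ i₂ ↦ Σ'_m ((1/2) • (M2Of 3 L tabs.mixFF 0 b.2 ↑b.1 βc.2 (translate Mc ↑βc.1 m)
+ sgnK (trK (same)))) X Z i₁ i₂)))|ff − κ₂ • (diagonal (Λ ∘ ↑·.1) · Ĉ − Ĉ · diagonal (Λ ∘ ↑·.1))`, `Ĉ := (perF T (dper T (tabs.H βc.2 ↑βc.1)))|ff` (`sum_tgrad_inl_mul_of_periodic`; `M2Z_eq` is `rfl`).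
USE (the row's (D-c)): `Λ := (u ↦ (sn r)⁻¹·lv ((sn r)•e_(wrapPt y, μ)) (wrapPt T u))`-class (PART 57), `T := towerTorus Lc (fine Lc (Mc B)) (n+1)`, `L := Lc^(n+2)`, `tabs := tabsRec n`; then `rw [← hM₂]` entrywise.
WHAT THIS IS NOT: not (T2) at the record (the `wΦ`-winding, (R3) `defKerZ_tsum`, PART 57 and the scalar pin are the row's (D-b)(D-c)); nothing of Bałaban's asserted, valued or discharged;
0 estimates; 0∕4 row-D1 binders (hW, hR, D1Tel, D1Rep); v10 NOT filed; NOT (C1), NOT (T-ID), NOT D1, NEVER «G-an2-4 closed», NOT BetaPertH, NOT continuum, NOT Clay.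
HONEST DEPENDENCY (page 1, mandatory): continuum YM on T⁴ ⇐ BetaPertH ∧ nine spine estimates (0/9 proved); BetaPertH ⇐ (D1) ∧ (D4) ∧ CAP+tail;
G-an2-4 gates asym, D1 and NE2/3/4.  HONEST FRAMING (cell contract, verbatim): «discharging `BetaPertH` makes Bałaban's UV stability UNCONDITIONAL —
a real constructive-QFT result; it is NOT the continuum limit and NOT the Clay problem.»  ABSOLUTE RULE (cell charter, verbatim): «No internally-minted
statement may enter as a cited fact. Every hypothesis is either kernel-proved in this package or a verbatim quotation of a PUBLISHED theorem with page
reference. The manuscript(s) under audit are NOT citable for their own disputed steps — they are the thing under adjudication; programme-internal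
(2001/route/tribunal) claims are never citable.»  Road «FP» OWNER, b2b-balaban-beta-d1-p3 gen 55, 2026-08-29.  No existing file touched.
-/

noncomputable section

open scoped BigOperators

namespace Summit.QuantumFields.BalabanUV.Beta.FP.TowerDoorDefectTorus

open Finset Matrix
open Literature.MathematicalPhysics.QuantumFieldTheory
open Literature.MathematicalPhysics.QuantumFieldTheory.Balaban1983to89
open Literature.MathematicalPhysics.QuantumFieldTheory.Balaban1983to89.Beta
open B12Sec2to5 (l1 l1_nonneg)
open B4TorusKernel.MultiPeriod (translate translate_apply)
open B6Lemma24Torus (pbox)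
open AffineAveraging (Site unitVec)
open OneStepResolventKernel (Fib)
open ExpKernelCalculus (MKer BiLoc VertexFamily)
open SecondOrderResponse (LocStencilFM)
open BalabanStepW2 (M2Of wM2)
open KernelWard (biLoc_finset_sum)
open Summit.QuantumFields.BalabanUV.Beta.SymmetrisedStepJets (SymTables)
open Summit.QuantumFields.BalabanUV.Beta.BorderedHessian (sgnK)
open Summit.QuantumFields.BalabanUV.Beta.TameKernelCalculus (trK)
open Summit.QuantumFields.BalabanUV.Beta.FP.KernelPeriodisationFib (Idx perF perZ perF_apply)
open Summit.QuantumFields.BalabanUV.Beta.FP.KernelPeriodisationFibLoc (dper)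
open Summit.QuantumFields.BalabanUV.Beta.FP.TorusGaugeCovariance (tgrad)
open Summit.QuantumFields.BalabanUV.Beta.FP.TowerDoorDefectDefs (M2Z defKerZ defKerZ_apply_inl_inl)
open Summit.QuantumFields.BalabanUV.Beta.FP.TowerDoorDefectLoc (biLoc_gradTerm)
open Summit.QuantumFields.BalabanUV.Beta.FP.TowerDoorPeriodisedLinear
open Summit.QuantumFields.BalabanUV.Beta.FP.TowerDoorDefectTorusPieces

variable (L : ℕ) (tabs : SymTables 3 L) (κ₂ : ℝ) (T Mc : Fin (3 + 1) → ℕ)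

/-! ## §1 The entry identity -/

/-- [folklore] `perZ T ∘ dper T` through the linear combination `Σ_κ G κ − c·(R − Cc)` at an entry, under PART 70's summability letters. -/
theorem perZ_dper_lincomb (G : Fin (3 + 1) → MKer (3 + 1) (Fib 3)) (R Cc : MKer (3 + 1) (Fib 3)) (c : ℝ) (x w : Site (3 + 1)) (a b : Fib 3)
    (hG : ∀ κ, Summable (fun p : (Site (3 + 1)) × (Site (3 + 1)) => G κ (translate T x p.2) (translate T (translate T w p.1) p.2) a b))
    (hR : Summable (fun p : (Site (3 + 1)) × (Site (3 + 1)) => R (translate T x p.2) (translate T (translate T w p.1) p.2) a b))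
    (hC : Summable (fun p : (Site (3 + 1)) × (Site (3 + 1)) => Cc (translate T x p.2) (translate T (translate T w p.1) p.2) a b)) :
    perZ T (dper T (fun (x' w' : Site (3 + 1)) (a' b' : Fib 3) => (∑ κ : Fin (3 + 1), G κ x' w' a' b') - c * (R x' w' a' b' - Cc x' w' a' b'))) x w a b
      = (∑ κ : Fin (3 + 1), perZ T (dper T (G κ)) x w a b) - c * (perZ T (dper T R) x w a b - perZ T (dper T Cc) x w a b) := by
  have h1 := perZ_dper_sub T (V := fun (x' w' : Site (3 + 1)) (a' b' : Fib 3) => ∑ κ : Fin (3 + 1), G κ x' w' a' b')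
    (W := fun (x' w' : Site (3 + 1)) (a' b' : Fib 3) => c * (R x' w' a' b' - Cc x' w' a' b')) x w a b (summable_sum fun κ _ => hG κ) ((hR.sub hC).mul_left c)
  have h2 := perZ_dper_finset_sum T Finset.univ G x w a b (fun κ _ => hG κ)
  have h3 := perZ_dper_const_mul T c (fun (x' w' : Site (3 + 1)) (a' b' : Fib 3) => R x' w' a' b' - Cc x' w' a' b') x w a b
  have h4 := perZ_dper_sub T (V := R) (W := Cc) x w a b hR hC
  rw [h1, h2, h3, h4]

/-- [folklore] on the field legs the defect kernel and its all-legs linear combination of pieces have the same `perZ T ∘ dper T` entry (PART 62 `defKerZ_apply_inl_inl` under PART 70 `perZ_dper_apply`). -/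
theorem perZ_dper_defKerZ_eq_pieces {Λ : Site (3 + 1) → ℝ} (β : Site (3 + 1) × Fin (3 + 1)) (x w : Site (3 + 1)) (α α' : Fin (3 + 1)) :
    perZ T (dper T (defKerZ L tabs κ₂ Λ β)) x w (Sum.inl α) (Sum.inl α')
      = perZ T (dper T (fun (x' w' : Site (3 + 1)) (a' b' : Fib 3) =>
          (∑ κ : Fin (3 + 1), (fun (κ' : Fin (3 + 1)) (X W : Site (3 + 1)) (i j : Fib 3) =>
              ∑' u : Site (3 + 1), (Λ (u + unitVec κ') - Λ u) * M2Z L tabs (u, κ') β X W i j) κ x' w' a' b')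
          - κ₂ * ((fun (X W : Site (3 + 1)) (i j : Fib 3) => Λ X * tabs.H β.2 β.1 X W i j) x' w' a' b'
              - (fun (X W : Site (3 + 1)) (i j : Fib 3) => tabs.H β.2 β.1 X W i j * Λ W) x' w' a' b'))) x w (Sum.inl α) (Sum.inl α') := by
  rw [perZ_dper_apply, perZ_dper_apply]
  refine tsum_congr fun t => tsum_congr fun j => ?_
  rw [defKerZ_apply_inl_inl]

/-- [folklore] **`perZ_dper_defKerZ_inl_inl` — THE FIELD–FIELD ENTRY OF `perF T ∘ dper T` OF THE DEFECT KERNEL OF A BOUNDED `T`-PERIODIC GAUGE FUNCTION**: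
`perZ T (dper T (defKerZ L tabs κ₂ Λ β)) x̄ w̄ (inl α) (inl α′) = Σ_{(r,κ)} (Λ(↑r+e_κ) − Λ ↑r)·perZ T (dper T (Σ'_m M2Z (↑r,κ) (translate Mc β.1 m, β.2))) x̄ w̄ (inl α) (inl α′) − κ₂·(Λ x̄·Ĉ − Ĉ·Λ w̄)`. -/
theorem perZ_dper_defKerZ_inl_inl [∀ i, NeZero (T i)] (hT : ∀ i, T i = L * Mc i) {C δ C_H δH V : ℝ} (hmix : LocStencilFM L tabs.mixFF C δ) (hδ : 0 < δ)
    (hH : VertexFamily tabs.H L C_H δH) (hδH : 0 < δH) {Λ : Site (3 + 1) → ℝ} (hV : 0 ≤ V) (hΛb : ∀ u, |Λ u| ≤ V) (hΛ : ∀ u m, Λ (translate T u m) = Λ u)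
    (β : Site (3 + 1) × Fin (3 + 1)) (x w : Site (3 + 1)) (α α' : Fin (3 + 1)) :
    perZ T (dper T (defKerZ L tabs κ₂ Λ β)) x w (Sum.inl α) (Sum.inl α')
      = (∑ b : ↥(pbox T) × Fin (3 + 1), (Λ ((b.1 : Site (3 + 1)) + unitVec b.2) - Λ (b.1 : Site (3 + 1)))
          * perZ T (dper T (fun (X Z : Site (3 + 1)) (i j : Fib 3) => ∑' m : Site (3 + 1), M2Z L tabs ((b.1 : Site (3 + 1)), b.2) (translate Mc β.1 m, β.2) X Z i j))
              x w (Sum.inl α) (Sum.inl α'))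
        - κ₂ * (Λ x * perZ T (dper T (tabs.H β.2 β.1)) x w (Sum.inl α) (Sum.inl α')
                - perZ T (dper T (tabs.H β.2 β.1)) x w (Sum.inl α) (Sum.inl α') * Λ w) := by
  rw [perZ_dper_defKerZ_eq_pieces L tabs κ₂ T β x w α α']
  rw [perZ_dper_lincomb T
    (fun (κ' : Fin (3 + 1)) (X W : Site (3 + 1)) (i j : Fib 3) => ∑' u : Site (3 + 1), (Λ (u + unitVec κ') - Λ u) * M2Z L tabs (u, κ') β X W i j)
    (fun (X W : Site (3 + 1)) (i j : Fib 3) => Λ X * tabs.H β.2 β.1 X W i j)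
    (fun (X W : Site (3 + 1)) (i j : Fib 3) => tabs.H β.2 β.1 X W i j * Λ W) κ₂ x w (Sum.inl α) (Sum.inl α')
    (fun κ => summable_perZ_dper_of_biLoc T (biLoc_gradTerm L tabs hmix hδ hV hΛb κ β) (half_pos hδ) x w _ _)
    (summable_perZ_dper_of_biLoc T (biLoc_rowK L tabs hH hV hΛb β) hδH x w _ _)
    (summable_perZ_dper_of_biLoc T (biLoc_colK L tabs hH hV hΛb β) hδH x w _ _)]
  rw [perZ_dper_rowK T hΛ, perZ_dper_colK T hΛ]
  simp only [perZ_dper_gradK L tabs T Mc hT hmix hδ hV hΛb hΛ]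
  rw [Fintype.sum_prod_type, Finset.sum_comm]

/-! ## §2 The matrix identity on the field block -/

/-- [folklore] **`submatrix_perF_dper_defKerZ` — (T2)'s SECOND SOCKET**: for a torus `T = L·Mc`, a bounded `T`-periodic gauge function `Λ`, (Lmix) and (LH), and a coarse window
`βc : ↥(pbox Mc) × Fin 4`: `(perF T (dper T (defKerZ L tabs κ₂ Λ (↑βc.1, βc.2))))|ff = Σ_b (Σ_s tgrad T (b.1, inl b.2) s · Λ ↑s) • (perF T (dper T (Σ'_m ½•(M2Of … b.2 ↑b.1 βc.2 (translate Mc ↑βc.1 m) + sgnK (trK …)))))|ff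
− κ₂ • (diagonal (Λ ∘ ↑·.1)·Ĉ − Ĉ·diagonal (Λ ∘ ↑·.1))`, `Ĉ := (perF T (dper T (tabs.H βc.2 ↑βc.1)))|ff` — v10 `hWΔT`'s bracket with `hM₂`'s right side in place of `(M₂ n B) b β`. -/
theorem submatrix_perF_dper_defKerZ [∀ i, NeZero (T i)] [∀ i, NeZero (Mc i)] (hT : ∀ i, T i = L * Mc i) {C δ C_H δH V : ℝ} (hmix : LocStencilFM L tabs.mixFF C δ) (hδ : 0 < δ)
    (hH : VertexFamily tabs.H L C_H δH) (hδH : 0 < δH) {Λ : Site (3 + 1) → ℝ} (hV : 0 ≤ V) (hΛb : ∀ u, |Λ u| ≤ V) (hΛ : ∀ u m, Λ (translate T u m) = Λ u)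
    (βc : ↥(pbox Mc) × Fin (3 + 1)) :
    (perF T (dper T (defKerZ L tabs κ₂ Λ ((βc.1 : Site (3 + 1)), βc.2)))).submatrix
        (fun b : ↥(pbox T) × Fin (3 + 1) => ((b.1, Sum.inl b.2) : Idx T (Fib 3))) (fun b : ↥(pbox T) × Fin (3 + 1) => ((b.1, Sum.inl b.2) : Idx T (Fib 3)))
      = (∑ b : ↥(pbox T) × Fin (3 + 1), (∑ s : ↥(pbox T), tgrad T (b.1, Sum.inl b.2) s * Λ (s : Site (3 + 1))) •
          (perF T (dper T (fun (X Z : Site (3 + 1)) (i₁ i₂ : Fib 3) => ∑' m : Site (3 + 1),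
            ((1 / 2 : ℝ) • (M2Of 3 L tabs.mixFF 0 b.2 (b.1 : Site (3 + 1)) βc.2 (translate Mc (βc.1 : Site (3 + 1)) m)
              + sgnK (trK (M2Of 3 L tabs.mixFF 0 b.2 (b.1 : Site (3 + 1)) βc.2 (translate Mc (βc.1 : Site (3 + 1)) m))))) X Z i₁ i₂))).submatrix
            (fun b : ↥(pbox T) × Fin (3 + 1) => ((b.1, Sum.inl b.2) : Idx T (Fib 3))) (fun b : ↥(pbox T) × Fin (3 + 1) => ((b.1, Sum.inl b.2) : Idx T (Fib 3))))
        - κ₂ • (Matrix.diagonal (fun b : ↥(pbox T) × Fin (3 + 1) => Λ (b.1 : Site (3 + 1)))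
              * (perF T (dper T (tabs.H βc.2 (βc.1 : Site (3 + 1))))).submatrix
                  (fun b : ↥(pbox T) × Fin (3 + 1) => ((b.1, Sum.inl b.2) : Idx T (Fib 3))) (fun b : ↥(pbox T) × Fin (3 + 1) => ((b.1, Sum.inl b.2) : Idx T (Fib 3)))
            - (perF T (dper T (tabs.H βc.2 (βc.1 : Site (3 + 1))))).submatrix
                  (fun b : ↥(pbox T) × Fin (3 + 1) => ((b.1, Sum.inl b.2) : Idx T (Fib 3))) (fun b : ↥(pbox T) × Fin (3 + 1) => ((b.1, Sum.inl b.2) : Idx T (Fib 3)))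
              * Matrix.diagonal (fun b : ↥(pbox T) × Fin (3 + 1) => Λ (b.1 : Site (3 + 1)))) := by
  ext b b'
  simp only [Matrix.submatrix_apply, Matrix.sub_apply, Matrix.smul_apply, Matrix.sum_apply, smul_eq_mul, Matrix.diagonal_mul, Matrix.mul_diagonal, perF_apply]
  rw [perZ_dper_defKerZ_inl_inl L tabs κ₂ T Mc hT hmix hδ hH hδH hV hΛb hΛ ((βc.1 : Site (3 + 1)), βc.2) (b.1 : Site (3 + 1)) (b'.1 : Site (3 + 1)) b.2 b'.2]
  congr 1
  refine Finset.sum_congr rfl fun b'' _ => ?_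
  rw [sum_tgrad_inl_mul_of_periodic T hΛ b''.1 b''.2]
  rfl

end Summit.QuantumFields.BalabanUV.Beta.FP.TowerDoorDefectTorus

end
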